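import Summits.AtomisticToContinuum.HydrodynamicLimit.Theorems.MourreKoopmanChargesLinearToEntropyInBandDefsB
import HarnessLib

/-!
# Route `MourreKoopmanCharges`, crux `LinearToEntropyInBand` (stmt-AtomisticToContinuum-17740), skeleton v7:
# toolkit for the visible window functional `visCoreN` — part A (pieces, linearity, kinetic bound)

Registered toolkit stub `stub_visCoreNToolkit` (`--supports` the crux; lead prover-line-…-17740-c4-0, wave 6), serving
the two XL stubs of skeleton v7 that manipulate the `N`-system visible functional `visCoreN` of
`…LinearToEntropyInBandDefsB` (e) (p161297): 4a-i `stub_visibleOneBlockEstimateInBand`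
(`VisibleFluxGibbsianity → VisibleOneBlockEstimateInBand`) and 4a-ii `stub_windowClauseOfOneBlockInBand` (Yau's
bookkeeping with the visible/invisible split), cf. the architecture audit AUDIT-4a § 2 (d), (e1)–(e3), § 3 item 5.
Nothing here restates the crux, a stub, or the Statement; no new posited object: the five `def`s below are the
three `let`-pieces of `visCoreN` given names (`visCoreN_eq` is `rfl`).

* § 0 `visKinN`, `visCollTermN` / `visCollN`, `visFluxDensityN` / `visFluxN` and `visCoreN_eq`:
  `visCoreN = w⁻¹ [∫ kin + Σᶠ coll − ∫ flux]` definitionally.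
* § 1 LINEARITY IN THE TEST FIELDS `(A₀, A₄, A)` (AUDIT-4a § 2 (e3): the test-field time grid of 4a-ii, and the
  `±A` / doubling manipulations of 4a-i): every piece is additive and homogeneous; `visCoreN_smul` holds
  UNCONDITIONALLY (junk included), `visCoreN_add` under the minimal integrability side conditions (finite collision
  set in the window, interval-integrable kinetic and flux orbit integrands, integrable flux densities) — all of which
  hold on the good set for continuous fields (`visCoreN_add_of_good`, part C `…VisCoreNToolkitC`).  The collision
  term is additive for CONTINUOUS `A, A₄` (its contact-segment integral is then an honest integral).
* § 2 the visible-particle bound of the kinetic piece `|kin(y)| ≤ (N+1)(a₀V + 3aV² + a₄V³/2)`, `V = K + ‖us‖_∞`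
  (AUDIT-4a § 2 (e3): kinetic freeze / grid errors are deterministic given `|v − us| ≤ K`).
* § 3 ON THE GOOD SET THE COLLISION PIECE IS A COLLISION PAIR SUM (AUDIT-4a § 2 (e1)): the raw `finsum` over
  collision times of `coll(Φ_{r⁻} z, Φ_r z)` equals `Φ.collisionPairSum S g z` with the configuration-level summand
  `g y i j = visCollTermN … (collidePair i j y) y i` (`ε_N < 1/2`: binary collisions, `leftLim_eq_collidePair`).  It is
  NOT a function of the collision record / mark: the density half of `VisibleN` sees every position.
Part B (`…VisCoreNToolkitB`): activity bound of the collision piece, measurability engines; part C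
(`…VisCoreNToolkitC`): flux-piece bounds, the measurable good version of `visCoreN`, good-set additivity.

References: H.-T. Yau, Lett. Math. Phys. 22 (1991) § 2; S. Olla, S. R. S. Varadhan, H.-T. Yau, Commun. Math. Phys.
155 (1993) § 3–4; I. Gallagher, L. Saint-Raymond, B. Texier, *From Newton to Boltzmann* (2013) § 4.1.
-/

noncomputable section

open MeasureTheory Filter Set
open scoped ENNReal Topology InnerProductSpace BigOperators

namespace Summit.AtomisticToContinuum.HydrodynamicLimit.Theorems.LTEInBand

open Literature.MathematicalPhysics.KineticTheory Literature.Analysis.FluidPDE Literature.Analysis.FunctionSpaces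

/-! ## § 0 The three pieces of `visCoreN` -/

/-- **The kinetic piece** `kin(y)` of `visCoreN` (DefsB (e)): the kinetic currents
`⟨A₀(xᵢ), vᵢ⟩ + A(xᵢ) : vᵢ ⊗ vᵢ + ⟨A₄(xᵢ), vᵢ⟩ |vᵢ|²/2` summed over the VISIBLE particles of the configuration `y`
(verbatim the `let kin` of `visCoreN`). -/
def visKinN (ρs : T3 → ℝ) (us : T3 → V3) (A₀ A₄ : T3 → V3) (A : Fin 3 → T3 → V3) (R K : ℝ) (N : ℕ)
    (y : Config (N + 1) (Fin 3) T3) : ℝ :=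
  ∑ i, if VisibleN ρs us R K N y i then ⟪A₀ (y i).1, (y i).2⟫_ℝ + (∑ j, ⟪A j (y i).1, (y i).2⟫_ℝ * (y i).2 j) + ⟪A₄ (y i).1, (y i).2⟫_ℝ * ‖(y i).2‖ ^ 2 / 2 else 0

/-- **The collision term of particle `i`** between a pre-collisional configuration `yl` and a post-collisional
one `yr` (verbatim the `i`-th summand of the `let coll` of `visCoreN`, `ε = hsDiameter σ N`): if `i` is visible in
BOTH, `(ε/2) ∫₀¹ [Σⱼ ⟨A_j(xᵢ − rεω), ω⟩ Δvⱼ + ⟨A₄(xᵢ − rεω), ω⟩ Δ|v|²/2] dr` along the contact segment,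
`Δv = vᵢ(yr) − vᵢ(yl)`, `ω = Δv/‖Δv‖` (junk `ω = 0` for a null transfer, which kills the term); else `0`. -/
def visCollTermN (σ : ℝ) (ρs : T3 → ℝ) (us : T3 → V3) (A₄ : T3 → V3) (A : Fin 3 → T3 → V3) (R K : ℝ)
    (N : ℕ) (yl yr : Config (N + 1) (Fin 3) T3) (i : Fin (N + 1)) : ℝ :=
  (let Δ : V3 := (yr i).2 - (yl i).2; let ω : V3 := ‖Δ‖⁻¹ • Δ; if VisibleN ρs us R K N yl i ∧ VisibleN ρs us R K N yr i then hsDiameter σ N / 2 * ∫ r in (0 : ℝ)..1, ((∑ j, ⟪A j ((yr i).1 + Torus.proj (-(r * hsDiameter σ N) • ω)), ω⟫_ℝ * Δ j) + ⟪A₄ ((yr i).1 + Torus.proj (-(r * hsDiameter σ N) • ω)), ω⟫_ℝ * (‖(yr i).2‖ ^ 2 - ‖(yl i).2‖ ^ 2) / 2) else 0)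

/-- **The collision piece** `coll(yl, yr) = Σᵢ visCollTermN … yl yr i` of `visCoreN` (verbatim its `let coll`). -/
def visCollN (σ : ℝ) (ρs : T3 → ℝ) (us : T3 → V3) (A₄ : T3 → V3) (A : Fin 3 → T3 → V3) (R K : ℝ)
    (N : ℕ) (yl yr : Config (N + 1) (Fin 3) T3) : ℝ :=
  ∑ i, visCollTermN σ ρs us A₄ A R K N yl yr i

/-- **The Euler-flux density** at `x` of the cone-smoothed visible block fields `(ρ̄, m̄, ē)` of `y` tested against
`(A₀, A, A₄)` (verbatim the integrand of the `let flux` of `visCoreN`: `w̄ = ρ̄⁻¹ m̄`,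
`p = ρ̄ (2/3)(ē/ρ̄ − |w̄|²/2) Z(min(ρ̄, 2ρs(x)) σ³)`; junk `ρ̄⁻¹ = 0`, `·/0 = 0`). -/
def visFluxDensityN (σ : ℝ) (ρs : T3 → ℝ) (us : T3 → V3) (A₀ A₄ : T3 → V3) (A : Fin 3 → T3 → V3)
    (R K k : ℝ) (N : ℕ) (y : Config (N + 1) (Fin 3) T3) (x : T3) : ℝ :=
  (let ρ : ℝ := visDensityN ρs us R K k N y x; let m : V3 := visMomentumN ρs us R K k N y x; let e : ℝ := visEnergyN ρs us R K k N y x; let wb : V3 := ρ⁻¹ • m; let p : ℝ := ρ * (2 / 3 * (e / ρ - ‖wb‖ ^ 2 / 2)) * hsCompressibility (min ρ (2 * ρs x) * σ ^ 3); ⟪A₀ x, m⟫_ℝ + (∑ j, (⟪A j x, m⟫_ℝ * wb j + p * A j x j)) + ⟪A₄ x, wb⟫_ℝ * (e + p))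

/-- **The flux piece** `flux(y) = (N+1) ∫_{𝕋³} visFluxDensityN … y x dx` of `visCoreN` (verbatim its `let flux`;
Bochner junk `0` if the density is not integrable — it is, `integrable_visFluxDensityN_and_abs_visFluxN_le` of part C). -/
def visFluxN (σ : ℝ) (ρs : T3 → ℝ) (us : T3 → V3) (A₀ A₄ : T3 → V3) (A : Fin 3 → T3 → V3)
    (R K k : ℝ) (N : ℕ) (y : Config (N + 1) (Fin 3) T3) : ℝ :=
  ((N : ℝ) + 1) * ∫ x, visFluxDensityN σ ρs us A₀ A₄ A R K k N y x

/-- **`visCoreN` in terms of its three named pieces** (definitional):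
`visCoreN = w⁻¹ [∫_s^{s+w} kin(Φ_r z) dr + Σᶠ_(collision times r ∈ (s, s+w]) coll(Φ_{r⁻} z, Φ_r z) − ∫_s^{s+w} flux(Φ_r z) dr]`,
`w = τ (N+1)^{-1/3}`. Every manipulation of stubs 4a-i/4a-ii starts here. -/
theorem visCoreN_eq (σ : ℝ) (ρs : T3 → ℝ) (us : T3 → V3) (A₀ A₄ : T3 → V3) (A : Fin 3 → T3 → V3)
    (R K τ k : ℝ) (N : ℕ) (Φ : HardSphereFlow (Torus.geometry (Fin 3)) (hsDiameter σ N) (N + 1))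
    (s : ℝ) (z : Config (N + 1) (Fin 3) T3) :
    visCoreN σ ρs us A₀ A₄ A R K τ k N Φ s z =
      (τ * ((N : ℝ) + 1) ^ (-(1 / 3 : ℝ)))⁻¹ *
        ((∫ r in s..(s + τ * ((N : ℝ) + 1) ^ (-(1 / 3 : ℝ))), visKinN ρs us A₀ A₄ A R K N (Φ.flow r z)) +
          (∑ᶠ r ∈ collisionTimes (Torus.geometry (Fin 3)) (hsDiameter σ N) (fun r' => Φ.flow r' z) ∩
              Set.Ioc s (s + τ * ((N : ℝ) + 1) ^ (-(1 / 3 : ℝ))),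
            visCollN σ ρs us A₄ A R K N (Function.leftLim (fun r' => Φ.flow r' z) r) (Φ.flow r z)) -
          ∫ r in s..(s + τ * ((N : ℝ) + 1) ^ (-(1 / 3 : ℝ))), visFluxN σ ρs us A₀ A₄ A R K k N (Φ.flow r z)) :=
  rfl

/-! ## § 1 Linearity in the test fields (AUDIT-4a § 2 (e3)) -/

section Linearity

variable (σ : ℝ) (ρs : T3 → ℝ) (us : T3 → V3) (A₀ A₀' A₄ A₄' : T3 → V3) (A A' : Fin 3 → T3 → V3)
  (R K k : ℝ) (N : ℕ) (c : ℝ)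

/-- The kinetic piece is additive in the test fields (pointwise, unconditional). -/
theorem visKinN_add (y : Config (N + 1) (Fin 3) T3) :
    visKinN ρs us (A₀ + A₀') (A₄ + A₄') (A + A') R K N y =
      visKinN ρs us A₀ A₄ A R K N y + visKinN ρs us A₀' A₄' A' R K N y := by
  unfold visKinN
  rw [← Finset.sum_add_distrib]
  refine Finset.sum_congr rfl fun i _ => ?_
  split_ifs
  · simp only [Pi.add_apply, inner_add_left, Finset.sum_add_distrib, add_mul]; ring
  · simp

/-- The kinetic piece is homogeneous in the test fields (pointwise, unconditional). -/
theorem visKinN_smul (y : Config (N + 1) (Fin 3) T3) :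
    visKinN ρs us (c • A₀) (c • A₄) (c • A) R K N y = c * visKinN ρs us A₀ A₄ A R K N y := by
  unfold visKinN
  rw [Finset.mul_sum]
  refine Finset.sum_congr rfl fun i _ => ?_
  split_ifs
  · simp only [Pi.smul_apply, real_inner_smul_left, mul_assoc, ← Finset.mul_sum]; ring
  · simp

/-- Continuity in the segment parameter of the contact-segment integrand (continuous fields). -/
theorem continuous_segmentIntegrand {A₄ : T3 → V3} {A : Fin 3 → T3 → V3} (hA₄ : Continuous A₄)
    (hA : ∀ j, Continuous (A j)) (x : T3) (ε : ℝ) (ω Δ : V3) (e : ℝ) :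
    Continuous fun r : ℝ =>
      (∑ j, ⟪A j (x + Torus.proj (-(r * ε) • ω)), ω⟫_ℝ * Δ j) + ⟪A₄ (x + Torus.proj (-(r * ε) • ω)), ω⟫_ℝ * e / 2 := by
  have hP : Continuous fun r : ℝ => x + Torus.proj (-(r * ε) • ω) :=
    continuous_const.add (Torus.continuous_proj.comp ((continuous_id.mul continuous_const).neg.smul continuous_const))
  exact (continuous_finsetSum _ fun j _ => (((hA j).comp hP).inner continuous_const).mul continuous_const).add
    (((((hA₄.comp hP).inner continuous_const).mul continuous_const)).div_const _)

/-- The collision term is homogeneous in the test fields (unconditional: constants leave interval integrals). -/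
theorem visCollTermN_smul (yl yr : Config (N + 1) (Fin 3) T3) (i : Fin (N + 1)) :
    visCollTermN σ ρs us (c • A₄) (c • A) R K N yl yr i = c * visCollTermN σ ρs us A₄ A R K N yl yr i := by
  unfold visCollTermN
  dsimp only
  split_ifs
  · rw [mul_left_comm]
    congr 1
    rw [← intervalIntegral.integral_const_mul c]
    refine intervalIntegral.integral_congr fun r _ => ?_
    simp only [Pi.smul_apply, real_inner_smul_left, mul_assoc, ← Finset.mul_sum]
    ring
  · simp

/-- The collision term is additive in CONTINUOUS test fields (the segment integrands are then integrable). -/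
theorem visCollTermN_add {A₄ A₄' : T3 → V3} {A A' : Fin 3 → T3 → V3} (hA₄ : Continuous A₄) (hA : ∀ j, Continuous (A j))
    (hA₄' : Continuous A₄') (hA' : ∀ j, Continuous (A' j)) (yl yr : Config (N + 1) (Fin 3) T3) (i : Fin (N + 1)) :
    visCollTermN σ ρs us (A₄ + A₄') (A + A') R K N yl yr i =
      visCollTermN σ ρs us A₄ A R K N yl yr i + visCollTermN σ ρs us A₄' A' R K N yl yr i := by
  unfold visCollTermN
  dsimp only
  split_ifs
  · rw [← mul_add, ← intervalIntegral.integral_add ((continuous_segmentIntegrand hA₄ hA _ _ _ _ _).intervalIntegrable _ _)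
      ((continuous_segmentIntegrand hA₄' hA' _ _ _ _ _).intervalIntegrable _ _)]
    congr 1
    refine intervalIntegral.integral_congr fun r _ => ?_
    simp only [Pi.add_apply, inner_add_left, Finset.sum_add_distrib, add_mul]
    ring
  · simp

/-- The collision piece is homogeneous in the test fields. -/
theorem visCollN_smul (yl yr : Config (N + 1) (Fin 3) T3) :
    visCollN σ ρs us (c • A₄) (c • A) R K N yl yr = c * visCollN σ ρs us A₄ A R K N yl yr := by
  unfold visCollN
  rw [Finset.mul_sum]
  exact Finset.sum_congr rfl fun i _ => visCollTermN_smul σ ρs us A₄ A R K N c yl yr i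

/-- The collision piece is additive in continuous test fields. -/
theorem visCollN_add {A₄ A₄' : T3 → V3} {A A' : Fin 3 → T3 → V3} (hA₄ : Continuous A₄) (hA : ∀ j, Continuous (A j))
    (hA₄' : Continuous A₄') (hA' : ∀ j, Continuous (A' j)) (yl yr : Config (N + 1) (Fin 3) T3) :
    visCollN σ ρs us (A₄ + A₄') (A + A') R K N yl yr =
      visCollN σ ρs us A₄ A R K N yl yr + visCollN σ ρs us A₄' A' R K N yl yr := by
  unfold visCollN
  rw [← Finset.sum_add_distrib]
  exact Finset.sum_congr rfl fun i _ => visCollTermN_add σ ρs us R K N hA₄ hA hA₄' hA' yl yr i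

/-- The stress pairing `Σ_j (⟪A_j(x), m⟫ w_j + p A_j(x)_j)` is additive in `A`. -/
theorem sum_stressPairing_add (A A' : Fin 3 → T3 → V3) (x : T3) (m wb : V3) (p : ℝ) :
    ∑ j, (⟪(A + A') j x, m⟫_ℝ * wb j + p * (A + A') j x j) =
      (∑ j, (⟪A j x, m⟫_ℝ * wb j + p * A j x j)) + ∑ j, (⟪A' j x, m⟫_ℝ * wb j + p * A' j x j) := by
  rw [← Finset.sum_add_distrib]
  refine Finset.sum_congr rfl fun j _ => ?_
  simp only [Pi.add_apply, PiLp.add_apply, inner_add_left]; ring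

/-- The stress pairing is homogeneous in `A`. -/
theorem sum_stressPairing_smul (c : ℝ) (A : Fin 3 → T3 → V3) (x : T3) (m wb : V3) (p : ℝ) :
    ∑ j, (⟪(c • A) j x, m⟫_ℝ * wb j + p * (c • A) j x j) = c * ∑ j, (⟪A j x, m⟫_ℝ * wb j + p * A j x j) := by
  rw [Finset.mul_sum]
  refine Finset.sum_congr rfl fun j _ => ?_
  simp only [Pi.smul_apply, PiLp.smul_apply, smul_eq_mul, real_inner_smul_left]; ring

/-- The flux density is additive in the test fields (pointwise, unconditional: the block fields do not see them). -/
theorem visFluxDensityN_add (y : Config (N + 1) (Fin 3) T3) (x : T3) :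
    visFluxDensityN σ ρs us (A₀ + A₀') (A₄ + A₄') (A + A') R K k N y x =
      visFluxDensityN σ ρs us A₀ A₄ A R K k N y x + visFluxDensityN σ ρs us A₀' A₄' A' R K k N y x := by
  unfold visFluxDensityN
  dsimp only
  rw [sum_stressPairing_add]
  simp only [Pi.add_apply, inner_add_left]
  ring

/-- The flux density is homogeneous in the test fields (pointwise, unconditional). -/
theorem visFluxDensityN_smul (y : Config (N + 1) (Fin 3) T3) (x : T3) :
    visFluxDensityN σ ρs us (c • A₀) (c • A₄) (c • A) R K k N y x =
      c * visFluxDensityN σ ρs us A₀ A₄ A R K k N y x := by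
  unfold visFluxDensityN
  dsimp only
  rw [sum_stressPairing_smul]
  simp only [Pi.smul_apply, real_inner_smul_left]
  ring

/-- The flux piece is homogeneous in the test fields (unconditional). -/
theorem visFluxN_smul (y : Config (N + 1) (Fin 3) T3) :
    visFluxN σ ρs us (c • A₀) (c • A₄) (c • A) R K k N y = c * visFluxN σ ρs us A₀ A₄ A R K k N y := by
  unfold visFluxN
  simp_rw [visFluxDensityN_smul]
  rw [integral_const_mul]; ring

/-- The flux piece is additive in the test fields as soon as the two flux densities are integrable over `𝕋³`
(Bochner junk otherwise; integrability: part C). -/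
theorem visFluxN_add (y : Config (N + 1) (Fin 3) T3)
    (h : Integrable (visFluxDensityN σ ρs us A₀ A₄ A R K k N y))
    (h' : Integrable (visFluxDensityN σ ρs us A₀' A₄' A' R K k N y)) :
    visFluxN σ ρs us (A₀ + A₀') (A₄ + A₄') (A + A') R K k N y =
      visFluxN σ ρs us A₀ A₄ A R K k N y + visFluxN σ ρs us A₀' A₄' A' R K k N y := by
  unfold visFluxN
  simp_rw [visFluxDensityN_add]
  rw [integral_add h h']; ring

/-- **Homogeneity of `visCoreN` in the test fields** — UNCONDITIONAL in the datum `z` and the fields (every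
interval / Bochner integral and the `finsum` commute with constants, junk values included; `mul_finsum_mem`).
Serves the `β`-scaling `β⁻¹ w·visCoreN(β∇λ)` of 4a-ii and the `±A` of 4a-i. -/
theorem visCoreN_smul (τ : ℝ) (Φ : HardSphereFlow (Torus.geometry (Fin 3)) (hsDiameter σ N) (N + 1)) (s : ℝ)
    (z : Config (N + 1) (Fin 3) T3) :
    visCoreN σ ρs us (c • A₀) (c • A₄) (c • A) R K τ k N Φ s z = c * visCoreN σ ρs us A₀ A₄ A R K τ k N Φ s z := by
  rw [visCoreN_eq, visCoreN_eq]
  simp_rw [visKinN_smul, visCollN_smul, visFluxN_smul]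
  rw [intervalIntegral.integral_const_mul, intervalIntegral.integral_const_mul, ← mul_finsum_mem]
  ring

/-- **Additivity of `visCoreN` in the test fields** under the MINIMAL side conditions: `A, A₄, A', A₄'` continuous
(collision term), finitely many collision times in the window (honest `finsum`), interval-integrable kinetic and
flux orbit integrands and integrable flux densities along the orbit (honest integrals).  On the good set with
continuous fields all of them hold: `visCoreN_add_of_good` (part C).  Serves the test-field time grid of 4a-ii
(AUDIT-4a § 2 (e3): `visCoreN(A_s) − visCoreN(A_{s_j}) = visCoreN(A_s − A_{s_j})`). -/
theorem visCoreN_add {A₀ A₀' A₄ A₄' : T3 → V3} {A A' : Fin 3 → T3 → V3} (τ : ℝ)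
    (Φ : HardSphereFlow (Torus.geometry (Fin 3)) (hsDiameter σ N) (N + 1)) (s : ℝ) (z : Config (N + 1) (Fin 3) T3)
    (hA₄ : Continuous A₄) (hA : ∀ j, Continuous (A j)) (hA₄' : Continuous A₄') (hA' : ∀ j, Continuous (A' j))
    (hfin : (collisionTimes (Torus.geometry (Fin 3)) (hsDiameter σ N) (fun r' => Φ.flow r' z) ∩
      Set.Ioc s (s + τ * ((N : ℝ) + 1) ^ (-(1 / 3 : ℝ)))).Finite)
    (hkin : IntervalIntegrable (fun r => visKinN ρs us A₀ A₄ A R K N (Φ.flow r z)) volume s (s + τ * ((N : ℝ) + 1) ^ (-(1 / 3 : ℝ))))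
    (hkin' : IntervalIntegrable (fun r => visKinN ρs us A₀' A₄' A' R K N (Φ.flow r z)) volume s (s + τ * ((N : ℝ) + 1) ^ (-(1 / 3 : ℝ))))
    (hfluxD : ∀ r, Integrable (visFluxDensityN σ ρs us A₀ A₄ A R K k N (Φ.flow r z)))
    (hfluxD' : ∀ r, Integrable (visFluxDensityN σ ρs us A₀' A₄' A' R K k N (Φ.flow r z)))
    (hflux : IntervalIntegrable (fun r => visFluxN σ ρs us A₀ A₄ A R K k N (Φ.flow r z)) volume s (s + τ * ((N : ℝ) + 1) ^ (-(1 / 3 : ℝ))))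
    (hflux' : IntervalIntegrable (fun r => visFluxN σ ρs us A₀' A₄' A' R K k N (Φ.flow r z)) volume s (s + τ * ((N : ℝ) + 1) ^ (-(1 / 3 : ℝ)))) :
    visCoreN σ ρs us (A₀ + A₀') (A₄ + A₄') (A + A') R K τ k N Φ s z =
      visCoreN σ ρs us A₀ A₄ A R K τ k N Φ s z + visCoreN σ ρs us A₀' A₄' A' R K τ k N Φ s z := by
  rw [visCoreN_eq, visCoreN_eq, visCoreN_eq]
  simp_rw [visKinN_add, visCollN_add σ ρs us R K N hA₄ hA hA₄' hA']
  have hF : ∀ r, visFluxN σ ρs us (A₀ + A₀') (A₄ + A₄') (A + A') R K k N (Φ.flow r z) =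
      visFluxN σ ρs us A₀ A₄ A R K k N (Φ.flow r z) + visFluxN σ ρs us A₀' A₄' A' R K k N (Φ.flow r z) := fun r =>
    visFluxN_add σ ρs us A₀ A₀' A₄ A₄' A A' R K k N _ (hfluxD r) (hfluxD' r)
  simp_rw [hF]
  rw [intervalIntegral.integral_add hkin hkin', intervalIntegral.integral_add hflux hflux',
    finsum_mem_add_distrib hfin]
  ring

end Linearity

/-! ## § 2 Visible-particle bound of the kinetic piece (AUDIT-4a § 2 (e3)) -/

section KineticBound

variable (ρs : T3 → ℝ) (R : ℝ) (N : ℕ)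

/-- A visible particle is slow: `‖vᵢ‖ ≤ K + ‖us(xᵢ)‖`. -/
theorem norm_vel_le_of_visibleN {us : T3 → V3} {K U : ℝ} (hus : ∀ x, ‖us x‖ ≤ U) {y : Config (N + 1) (Fin 3) T3}
    {i : Fin (N + 1)} (h : VisibleN ρs us R K N y i) : ‖(y i).2‖ ≤ K + U :=
  calc ‖(y i).2‖ = ‖((y i).2 - us (y i).1) + us (y i).1‖ := by rw [sub_add_cancel]
    _ ≤ ‖(y i).2 - us (y i).1‖ + ‖us (y i).1‖ := norm_add_le _ _
    _ ≤ K + U := add_le_add h.1 (hus _)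

/-- **Visible-particle bound of the kinetic piece**: with `‖A₀‖_∞ ≤ a₀`, `‖A_j‖_∞ ≤ a`, `‖A₄‖_∞ ≤ a₄`,
`‖us‖_∞ ≤ U` and `V = K + U ≥ 0`, `|kin(y)| ≤ (N+1) (a₀ V + 3 a V² + a₄ V³/2)` for EVERY configuration. -/
theorem abs_visKinN_le {us : T3 → V3} {A₀ A₄ : T3 → V3} {A : Fin 3 → T3 → V3} {K U a₀ a a₄ : ℝ}
    (hA₀ : ∀ x, ‖A₀ x‖ ≤ a₀) (hA : ∀ j x, ‖A j x‖ ≤ a) (hA₄ : ∀ x, ‖A₄ x‖ ≤ a₄) (hus : ∀ x, ‖us x‖ ≤ U)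
    (hV : 0 ≤ K + U) (y : Config (N + 1) (Fin 3) T3) :
    |visKinN ρs us A₀ A₄ A R K N y| ≤
      ((N : ℝ) + 1) * (a₀ * (K + U) + 3 * a * (K + U) ^ 2 + a₄ * (K + U) ^ 3 / 2) := by
  have ha₀ : 0 ≤ a₀ := (norm_nonneg _).trans (hA₀ 0)
  have ha : 0 ≤ a := (norm_nonneg _).trans (hA 0 0)
  have ha₄ : 0 ≤ a₄ := (norm_nonneg _).trans (hA₄ 0)
  unfold visKinN
  refine (Finset.abs_sum_le_sum_abs _ _).trans ?_
  have hcard : ∑ _i : Fin (N + 1), (a₀ * (K + U) + 3 * a * (K + U) ^ 2 + a₄ * (K + U) ^ 3 / 2) =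
      ((N : ℝ) + 1) * (a₀ * (K + U) + 3 * a * (K + U) ^ 2 + a₄ * (K + U) ^ 3 / 2) := by
    rw [Finset.sum_const, Finset.card_univ, Fintype.card_fin, nsmul_eq_mul]
    push_cast
    ring
  rw [← hcard]
  refine Finset.sum_le_sum fun i _ => ?_
  split_ifs with hvis
  · have hv := norm_vel_le_of_visibleN ρs R N hus hvis
    have hv0 : 0 ≤ ‖(y i).2‖ := norm_nonneg _
    refine (abs_add_le _ _).trans (add_le_add ((abs_add_le _ _).trans (add_le_add ?_ ?_)) ?_)
    · exact (abs_real_inner_le_norm _ _).trans (mul_le_mul (hA₀ _) hv hv0 ha₀)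
    · refine (Finset.abs_sum_le_sum_abs _ _).trans ?_
      have h3 : ∑ _j : Fin 3, a * (K + U) ^ 2 = 3 * a * (K + U) ^ 2 := by
        rw [Finset.sum_const, Finset.card_univ, Fintype.card_fin, nsmul_eq_mul]
        push_cast
        ring
      rw [← h3]
      refine Finset.sum_le_sum fun j _ => ?_
      rw [abs_mul, pow_two, ← mul_assoc]
      refine mul_le_mul ((abs_real_inner_le_norm _ _).trans (mul_le_mul (hA j _) hv hv0 ha)) ?_ (abs_nonneg _)
        (by positivity)
      exact le_trans (by simpa using PiLp.norm_apply_le (y i).2 j) hv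
    · rw [abs_div, abs_mul, abs_two, abs_of_nonneg (by positivity : 0 ≤ ‖(y i).2‖ ^ 2)]
      have h1 : |⟪A₄ (y i).1, (y i).2⟫_ℝ| ≤ a₄ * (K + U) :=
        (abs_real_inner_le_norm _ _).trans (mul_le_mul (hA₄ _) hv hv0 ha₄)
      have h2 : ‖(y i).2‖ ^ 2 ≤ (K + U) ^ 2 := pow_le_pow_left₀ hv0 hv 2
      calc |⟪A₄ (y i).1, (y i).2⟫_ℝ| * ‖(y i).2‖ ^ 2 / 2 ≤ a₄ * (K + U) * (K + U) ^ 2 / 2 := by gcongr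
        _ = a₄ * (K + U) ^ 3 / 2 := by ring
  · rw [abs_zero]
    positivity

end KineticBound

/-! ## § 3 The collision piece on the good set is a collision pair sum (AUDIT-4a § 2 (e1)) -/

section Collision

variable (σ : ℝ) (ρs : T3 → ℝ) (us : T3 → V3) (A₄ : T3 → V3) (A : Fin 3 → T3 → V3) (R K : ℝ) (N : ℕ)

/-- A particle whose one-particle state does not jump contributes nothing to the collision piece. -/
theorem visCollTermN_eq_zero_of_eq {yl yr : Config (N + 1) (Fin 3) T3} {i : Fin (N + 1)} (h : yl i = yr i) :
    visCollTermN σ ρs us A₄ A R K N yl yr i = 0 := by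
  unfold visCollTermN; dsimp only; rw [h, sub_self, sub_self]; simp

/-- At the elastic collision of the pair `(i, j)` only the two partners contribute. -/
theorem visCollN_collidePair_eq (y : Config (N + 1) (Fin 3) T3) {i j : Fin (N + 1)} (hij : i ≠ j) :
    visCollN σ ρs us A₄ A R K N (collidePair (Torus.geometry (Fin 3)) i j y) y =
      visCollTermN σ ρs us A₄ A R K N (collidePair (Torus.geometry (Fin 3)) i j y) y i +
        visCollTermN σ ρs us A₄ A R K N (collidePair (Torus.geometry (Fin 3)) i j y) y j := by
  unfold visCollN
  refine Finset.sum_eq_add_of_mem i j (Finset.mem_univ _) (Finset.mem_univ _) hij fun k _ hk => ?_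
  exact visCollTermN_eq_zero_of_eq σ ρs us A₄ A R K N (collidePair_apply_of_ne hk.1 hk.2 y)

/-- **The collision piece of `visCoreN` IS a collision pair sum along the flow** (good data, `ε_N < 1/2`):
the raw `finsum` over the collision times in `S` of `coll(Φ_{r⁻} z, Φ_r z)` equals
`Φ.collisionPairSum S g z` with the time-independent summand
`g y i j = visCollTermN … (collidePair i j y) y i` — the contribution of the FIRST partner `i` of the ordered
contact pair `(i, j)`, its pre-collisional state read off the post-collisional configuration `y` by the elastic
involution (`leftLim_eq_collidePair`; binary collisions, `contactPairs_eq_pair`; `collidePair_comm`).  The summand is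
NOT a function of the collision record/mark alone: the density half of `VisibleN` sees every position of `y`. -/
theorem finsum_visCollN_eq_collisionPairSum {σ : ℝ} {N : ℕ} (hε : hsDiameter σ N < 2⁻¹)
    (Φ : HardSphereFlow (Torus.geometry (Fin 3)) (hsDiameter σ N) (N + 1)) {z : Config (N + 1) (Fin 3) T3}
    (hz : z ∈ Φ.good) (S : Set ℝ) :
    ∑ᶠ r ∈ collisionTimes (Torus.geometry (Fin 3)) (hsDiameter σ N) (fun r' => Φ.flow r' z) ∩ S,
        visCollN σ ρs us A₄ A R K N (Function.leftLim (fun r' => Φ.flow r' z) r) (Φ.flow r z) =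
      Φ.collisionPairSum S (fun _ y i j =>
        visCollTermN σ ρs us A₄ A R K N (collidePair (Torus.geometry (Fin 3)) i j y) y i) z := by
  have hG := Torus.isHardSphereRegular_geometry (d := Fin 3) hε
  have htraj := Φ.isTrajectory z hz
  rw [HardSphereFlow.collisionPairSum, Literature.Analysis.FluidPDE.collisionPairSum]
  refine finsum_mem_congr rfl fun r hr => ?_
  obtain ⟨p, q, hpq, hc⟩ := mem_collisionTimes.1 hr.1
  have hp : (p, q) ∈ contactPairs (Torus.geometry (Fin 3)) (hsDiameter σ N) (Φ.flow r z) :=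
    mem_contactPairs.2 ⟨hpq, hc⟩
  have hne : (p, q) ≠ (q, p) := fun h => hpq (Prod.mk.inj h).1
  rw [htraj.contactPairs_eq_pair hG hp, Finset.sum_pair hne, htraj.leftLim_eq_collidePair hpq hc,
    visCollN_collidePair_eq σ ρs us A₄ A R K N _ hpq, hG.collidePair_comm hpq (mem_contactSet.1 hc).2.le]

end Collision

/-! ## The registered toolkit stub -/

/-- **Registered toolkit stub `stub_visCoreNToolkit` (part A)** of skeleton v7 (crux stmt-17740): homogeneity of
`visCoreN` in the test fields (unconditional), the visible-particle bound of the kinetic piece, and the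
collision-pair-sum form of the collision piece on the good set.  Sorry-free conjunction of `visCoreN_smul`,
`abs_visKinN_le`, `finsum_visCollN_eq_collisionPairSum` (additivity, `visCoreN_add`, is the fourth headline lemma of
the file; its eleven side conditions do not fit a registered one-paragraph signature). -/
theorem stub_visCoreNToolkit : (∀ (σ : ℝ) (ρs : Literature.MathematicalPhysics.KineticTheory.T3 → ℝ) (us A₀ A₄ : Literature.MathematicalPhysics.KineticTheory.T3 → Literature.MathematicalPhysics.KineticTheory.V3) (A : Fin 3 → Literature.MathematicalPhysics.KineticTheory.T3 → Literature.MathematicalPhysics.KineticTheory.V3) (R K k : ℝ) (N : ℕ) (c τ : ℝ) (Φ : Literature.Analysis.FluidPDE.HardSphereFlow (Literature.Analysis.FluidPDE.Torus.geometry (Fin 3)) (Literature.MathematicalPhysics.KineticTheory.hsDiameter σ N) (N + 1)) (s : ℝ) (z : Literature.Analysis.FluidPDE.Config (N + 1) (Fin 3) Literature.MathematicalPhysics.KineticTheory.T3), Summit.AtomisticToContinuum.HydrodynamicLimit.Theorems.LTEInBand.visCoreN σ ρs us (c • A₀) (c • A₄) (c • A) R K τ k N Φ s z = c * Summit.AtomisticToContinuum.HydrodynamicLimit.Theorems.LTEInBand.visCoreN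 σ ρs us A₀ A₄ A R K τ k N Φ s z) ∧ (∀ (ρs : Literature.MathematicalPhysics.KineticTheory.T3 → ℝ) (us A₀ A₄ : Literature.MathematicalPhysics.KineticTheory.T3 → Literature.MathematicalPhysics.KineticTheory.V3) (A : Fin 3 → Literature.MathematicalPhysics.KineticTheory.T3 → Literature.MathematicalPhysics.KineticTheory.V3) (R K U a₀ a a₄ : ℝ) (N : ℕ), (∀ x, ‖A₀ x‖ ≤ a₀) → (∀ j x, ‖A j x‖ ≤ a) → (∀ x, ‖A₄ x‖ ≤ a₄) → (∀ x, ‖us x‖ ≤ U) → 0 ≤ K + U → ∀ y : Literature.Analysis.FluidPDE.Config (N + 1) (Fin 3) Literature.MathematicalPhysics.KineticTheory.T3, |Summit.AtomisticToContinuum.HydrodynamicLimit.Theorems.LTEInBand.visKinN ρs us A₀ A₄ A R K N y| ≤ ((N : ℝ) + 1) * (a₀ * (K + U) + 3 * a * (K + U) ^ 2 + a₄ * (K + U) ^ 3 / 2)) ∧ (∀ (σ : ℝ) (ρs : Literature.MathematicalPhysics.KineticTheory.T3 → ℝ) (us A₄ : Literature.MathematicalPhysics.KineticTheory.T3 → Literature.MathematicalPhysics.KineticTheory.V3)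 (A : Fin 3 → Literature.MathematicalPhysics.KineticTheory.T3 → Literature.MathematicalPhysics.KineticTheory.V3) (R K : ℝ) (N : ℕ), Literature.MathematicalPhysics.KineticTheory.hsDiameter σ N < 2⁻¹ → ∀ (Φ : Literature.Analysis.FluidPDE.HardSphereFlow (Literature.Analysis.FluidPDE.Torus.geometry (Fin 3)) (Literature.MathematicalPhysics.KineticTheory.hsDiameter σ N) (N + 1)) (z : Literature.Analysis.FluidPDE.Config (N + 1) (Fin 3) Literature.MathematicalPhysics.KineticTheory.T3), z ∈ Φ.good → ∀ S : Set ℝ, ∑ᶠ r ∈ Literature.Analysis.FluidPDE.collisionTimes (Literature.Analysis.FluidPDE.Torus.geometry (Fin 3)) (Literature.MathematicalPhysics.KineticTheory.hsDiameter σ N) (fun r' => Φ.flow r' z) ∩ S, Summit.AtomisticToContinuum.HydrodynamicLimit.Theorems.LTEInBand.visCollN σ ρs us A₄ A R K N (Function.leftLim (fun r' => Φ.flow r' z) r) (Φ.flow r z) = Φ.collisionPairSum S (fun _ y i j => Summit.AtomisticToContinuum.HydrodynamicLimit.Theorems.LTEInBand.visCollTermN σ ρs us A₄ A R K N (Literature.Analysis.FluidPDE.collidePair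 (Literature.Analysis.FluidPDE.Torus.geometry (Fin 3)) i j y) y i) z) :=
  ⟨fun σ ρs us A₀ A₄ A R K k N c τ Φ s z => visCoreN_smul σ ρs us A₀ A₄ A R K k N c τ Φ s z,
    fun ρs _ _ _ _ R _ _ _ _ _ N hA₀ hA hA₄ hus hV y => abs_visKinN_le ρs R N hA₀ hA hA₄ hus hV y,
    fun _ ρs us A₄ A R K _ hε Φ _ hz S => finsum_visCollN_eq_collisionPairSum ρs us A₄ A R K hε Φ hz S⟩

end Summit.AtomisticToContinuum.HydrodynamicLimit.Theorems.LTEInBand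

end
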